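import Summits.ValiantsHypothesis.ValiantsHypothesis.Theorems.GrenetZeonDualUnipotentThreeHalvesLongMassMonomialWalk

/-!
# `GrenetZeon.DualUnipotentThreeHalves` (stmt-ValiantsHypothesis-24318), line `slow_core`, stub (c) `SlowCore.LongMassSlowLawInv`:
# MONOMIAL WALKS II — closed chains witness NON-nilpotency; DESCENDING chains (helices) are the instrument nilpotent pencils realise

Sequel to ✓ `…LongMassMonomialWalk` (same hand), which proved the monomial-walk identity `(A + sB)^L w₀ = s^{#B-steps} w_L`
(`pow_mulVec_of_monomialWalk`), its ledger reading ★ `weight_le_of_ledger`, and the LEVEL-FREE closed-chain corollaries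
`pow_mulVec_of_closedChain` / `mul_le_of_ledger_of_closedChain`.

SCOPE CORRECTION (this file, §1).  A level-free closed chain makes `A + B` act as a `q`-cycle on `span{u_i}`, so NO power of `A + B`
vanishes (`not_pow_eq_zero_of_closedChain`).  For the pencils of (c) — `B ^ b = 0` as a polynomial matrix, so every `N(x) + lin v = N(x + v)`
is nilpotent — the closed-chain corollaries of the first file are therefore correct but VACUOUS; they bear on non-nilpotent affine pencils only.

THE HONEST INSTANCE (§2).  What nilpotent pencils DO realise is the DESCENDING closed chain (helix): vectors `u a i` on levels `a ≤ T`,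
chain positions `i < q` (`q ≥ 2`), every step dropping ONE level —
`lin v : u (a+1) (i+1) ↦ u a i`, `u (a+1) 0 ↦ 0`;  `N(x) : u (a+1) 0 ↦ u a (q−1)`, `u (a+1) i ↦ 0` (`1 ≤ i < q`).
Then `(N(x) + s·lin v)^{q} (u (a+q) 0) = s^{q−1} (u a 0)` (`pow_mulVec_of_descChain`, one turn = the monomial walk
`u (a+q) 0 →N(x) u (a+q−1) (q−1) →lin v ⋯ →lin v u a 0`), `j` turns `pow_mul_mulVec_of_descChain`, and
★ `mul_le_of_ledger_of_descChain`: in a whole-pencil ledger `(K, k)` ∋ `v`, `j·(q − 1) ≤ k` whenever `j·q ≤ min(T, n − 1)`.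
The index shadow (✓ `LedgerIndex.linMat_pow_eq_zero_of_ledger`) only gives `q − 1 ≤ k`.  Realised by the REPEATED-BLOCK pencils
`N = S_ℓ ⊗ X` (`S_ℓ` the `ℓ × ℓ` shift, `X` the generic `r × r` matrix; triangularisable): for a direction `S_ℓ ⊗ X_D` with a Jordan chain
`u'_{q−1} ↦ ⋯ ↦ u'_0 ↦ 0` of `X_D` and the point `S_ℓ ⊗ X_P`, `X_P u'_0 = u'_{q−1}`, `X_P u'_i = 0`, the vectors `u a i = e_a ⊗ u'_i` form a
descending chain of height `T = ℓ − 1`; hence NO nonzero direction survives in a ledger of order `k < (ℓ − 3)/2` (window-flatness) although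
the index-`2` directions `S_ℓ ⊗ X_D`, `X_D² = 0`, have dimension `⌊r²/4⌋` (memo `FIFTEENTH-HAND.md` on 24318 / 8062, §2–§3).
§3: by-name shadows `exists_descChainShadow_of_relCert`, `descChainShadow_of_longMassSlowLawInv`.

HONEST FRAMING.  An INSTRUMENT / necessary condition (`--supports stmt-ValiantsHypothesis-24318`); NOT progress on (c) `LongMassSlowLawInv`
(RESEARCH — OPEN); closes no stub; S3, 24318, 8062 (`stub_dualUnipotent`) and `VP ≠ VNP` are NOT proved.  Def-free, no named facts, no sorry.
[folklore: weighted walks / helices]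
-/

set_option linter.dupNamespace false
set_option autoImplicit false

noncomputable section

namespace Summit.ValiantsHypothesis.ValiantsHypothesis.Theorems.GrenetZeon.MonomialWalk

open MvPolynomial Matrix
open scoped BigOperators
open Summit.ValiantsHypothesis.ValiantsHypothesis.Cruxes.TwoDimCoefficients.DimTwoCases (AffMat IsAffine)
open Summit.ValiantsHypothesis.ValiantsHypothesis.Theorems.GrenetZeon.RadicalSplit (lineSubst)
open Summit.ValiantsHypothesis.ValiantsHypothesis.Theorems.GrenetZeon.SlowCore (Ledger)
open Summit.ValiantsHypothesis.ValiantsHypothesis.Theorems.GrenetZeon.ResolventFlag (linMat pointMat)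

variable {m : ℕ}

/-! ## §1 Level-free closed chains are incompatible with nilpotency -/

/-- Evaluating the cast line matrix at `s = 1` gives `A + B`. [folklore] -/
theorem map_eval_one_lineMat (A B : Matrix (Fin m) (Fin m) ℂ) :
    (A.map (C : ℂ →+* MvPolynomial (Fin 1) ℂ) + (X 0 : MvPolynomial (Fin 1) ℂ) • B.map (C : ℂ →+* MvPolynomial (Fin 1) ℂ)).map
        (MvPolynomial.eval fun _ : Fin 1 => (1 : ℂ)) = A + B := by
  ext i j
  simp [Matrix.map_apply]

/-- **A closing value witnesses NON-nilpotency.**  Under the hypotheses of `pow_mulVec_of_closedChain` (`u₀ ≠ 0`), no power of `A + B` vanishes: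
`(A + B)^{jq} u₀ = u₀`.  Hence §4–§5 never apply to a point value / direction pair of a NILPOTENT affine pencil (`N(x) + lin v = N(x + v)`);
they concern non-nilpotent affine pencils only.  [folklore: a weighted cycle is not nilpotent] -/
theorem not_pow_eq_zero_of_closedChain (A B : Matrix (Fin m) (Fin m) ℂ) (q : ℕ) (hq : 2 ≤ q) (u : ℕ → Fin m → ℂ) (hu0 : u 0 ≠ 0)
    (hB0 : B *ᵥ u 0 = 0) (hB : ∀ i, i + 1 < q → B *ᵥ u (i + 1) = u i)
    (hA0 : A *ᵥ u 0 = u (q - 1)) (hA : ∀ i, 1 ≤ i → i < q → A *ᵥ u i = 0) (p : ℕ) :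
    (A + B) ^ p ≠ 0 := by
  intro hp
  -- `(A+B)^{p·q} u₀ = u₀` by evaluating the `s`-identity at `s = 1`, but `(A+B)^{p·q} = 0` when `p ≥ 1`; `p = 0` is `1 ≠ 0`.
  obtain ⟨i₀, hi₀⟩ := Function.ne_iff.mp hu0
  rcases Nat.eq_zero_or_pos p with rfl | hpos
  · rw [pow_zero] at hp
    have h10 := congr_fun (congr_fun hp i₀) i₀
    simp at h10
  · have hturn := pow_mul_mulVec_of_closedChain A B q hq u hB0 hB hA0 hA p
    set φ : MvPolynomial (Fin 1) ℂ →+* ℂ := MvPolynomial.eval fun _ : Fin 1 => (1 : ℂ) with hφ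
    have hev := congr_arg (fun f : Fin m → MvPolynomial (Fin 1) ℂ => fun i => φ (f i)) hturn
    have hl : (fun i => φ ((((A.map (C : ℂ →+* MvPolynomial (Fin 1) ℂ) +
          (X 0 : MvPolynomial (Fin 1) ℂ) • B.map (C : ℂ →+* MvPolynomial (Fin 1) ℂ)) ^ (p * q)) *ᵥ fun i => C (u 0 i)) i)) =
        ((A + B) ^ (p * q)) *ᵥ u 0 := by
      funext i
      rw [RingHom.map_mulVec φ, Matrix.map_pow, hφ, map_eval_one_lineMat]
      congr 1
      funext i'
      simp
    have hr : (fun i => φ (((X 0 : MvPolynomial (Fin 1) ℂ) ^ (p * (q - 1)) • fun i => C (u 0 i)) i)) = u 0 := by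
      funext i
      simp [hφ]
    rw [hl, hr, pow_mul, hp, zero_pow (by omega : q ≠ 0), Matrix.zero_mulVec] at hev
    exact hu0 hev.symm

/-! ## §2 Descending closed chains (helices) — the instance nilpotent pencils realise -/

/-- ★ **ONE TURN OF A DESCENDING CHAIN.**  Levels `a ≤ T`, width `q ≥ 2`, vectors `u a i`; every step drops one level:
`B (u (a+1) 0) = 0`, `B (u (a+1) (i+1)) = u a i` (`i + 1 < q`), `A (u (a+1) 0) = u a (q−1)`, `A (u (a+1) i) = 0` (`1 ≤ i < q`).  Then
`(A + sB)^q (u (a+q) 0) = s^{q−1} · (u a 0)` whenever `a + q ≤ T`. [folklore: weighted helix] -/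
theorem pow_mulVec_of_descChain (A B : Matrix (Fin m) (Fin m) ℂ) (q T : ℕ) (hq : 2 ≤ q) (u : ℕ → ℕ → Fin m → ℂ)
    (hB0 : ∀ a, a + 1 ≤ T → B *ᵥ u (a + 1) 0 = 0)
    (hB : ∀ a i, a + 1 ≤ T → i + 1 < q → B *ᵥ u (a + 1) (i + 1) = u a i)
    (hA0 : ∀ a, a + 1 ≤ T → A *ᵥ u (a + 1) 0 = u a (q - 1))
    (hA : ∀ a i, a + 1 ≤ T → 1 ≤ i → i < q → A *ᵥ u (a + 1) i = 0)
    (a : ℕ) (ha : a + q ≤ T) :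
    ((A.map (C : ℂ →+* MvPolynomial (Fin 1) ℂ) + (X 0 : MvPolynomial (Fin 1) ℂ) • B.map (C : ℂ →+* MvPolynomial (Fin 1) ℂ)) ^ q) *ᵥ
        (fun i => C (u (a + q) 0 i)) =
      (X 0 : MvPolynomial (Fin 1) ℂ) ^ (q - 1) • (fun i => C (u a 0 i)) := by
  -- the walk `u (a+q) 0 →(A) u (a+q-1) (q-1) →(B) u (a+q-2) (q-2) →(B) ⋯ →(B) u a 0`
  set w : ℕ → Fin m → ℂ := fun t => if t = 0 then u (a + q) 0 else u (a + q - t) (q - t) with hw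
  set ε : ℕ → ℕ := fun t => if t = 0 then 0 else 1 with hε
  have hstep : ∀ t, t < q →
      (ε t = 0 ∧ A *ᵥ w t = w (t + 1) ∧ B *ᵥ w t = 0) ∨ (ε t = 1 ∧ A *ᵥ w t = 0 ∧ B *ᵥ w t = w (t + 1)) := by
    intro t ht
    by_cases h0 : t = 0
    · subst h0
      left
      have h1 : a + q = (a + q - 1) + 1 := by omega
      have keyA : A *ᵥ u (a + q) 0 = u (a + q - 1) (q - 1) := by
        have := hA0 (a + q - 1) (by omega)
        rwa [← h1] at this
      have keyB : B *ᵥ u (a + q) 0 = 0 := by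
        have := hB0 (a + q - 1) (by omega)
        rwa [← h1] at this
      refine ⟨by simp [hε], ?_, ?_⟩
      · simp only [hw, if_pos rfl, if_neg (Nat.succ_ne_zero 0)]
        exact keyA
      · simp only [hw, if_pos rfl]
        exact keyB
    · right
      have hL : a + q - t = (a + q - (t + 1)) + 1 := by omega
      have hP : q - t = (q - (t + 1)) + 1 := by omega
      refine ⟨by simp [hε, h0], ?_, ?_⟩
      · simp only [hw, if_neg h0]
        rw [hL, hP]
        exact hA _ _ (by omega) (by omega) (by omega)
      · simp only [hw, if_neg h0, if_neg (Nat.succ_ne_zero t)]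
        rw [hL, hP]
        exact hB _ _ (by omega) (by omega)
  have hmain := pow_mulVec_of_monomialWalk A B q w ε hstep
  have hw0 : w 0 = u (a + q) 0 := by simp [hw]
  have hwq : w q = u a 0 := by
    simp only [hw]
    rw [if_neg (by omega), Nat.sub_self]
    congr 1
    omega
  have hsum : ∑ t ∈ Finset.range q, ε t = q - 1 := by
    obtain ⟨q', rfl⟩ : ∃ q', q = q' + 1 := ⟨q - 1, by omega⟩
    rw [Finset.sum_range_succ']
    simp [hε]
  rw [hw0, hwq, hsum] at hmain
  exact hmain

/-- `j` turns of a descending chain: `(A + sB)^{j·q} (u (a + j·q) 0) = s^{j·(q−1)} · (u a 0)` whenever `a + j·q ≤ T`. -/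
theorem pow_mul_mulVec_of_descChain (A B : Matrix (Fin m) (Fin m) ℂ) (q T : ℕ) (hq : 2 ≤ q) (u : ℕ → ℕ → Fin m → ℂ)
    (hB0 : ∀ a, a + 1 ≤ T → B *ᵥ u (a + 1) 0 = 0)
    (hB : ∀ a i, a + 1 ≤ T → i + 1 < q → B *ᵥ u (a + 1) (i + 1) = u a i)
    (hA0 : ∀ a, a + 1 ≤ T → A *ᵥ u (a + 1) 0 = u a (q - 1))
    (hA : ∀ a i, a + 1 ≤ T → 1 ≤ i → i < q → A *ᵥ u (a + 1) i = 0)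
    (j a : ℕ) (ha : a + j * q ≤ T) :
    ((A.map (C : ℂ →+* MvPolynomial (Fin 1) ℂ) + (X 0 : MvPolynomial (Fin 1) ℂ) • B.map (C : ℂ →+* MvPolynomial (Fin 1) ℂ)) ^ (j * q)) *ᵥ
        (fun i => C (u (a + j * q) 0 i)) =
      (X 0 : MvPolynomial (Fin 1) ℂ) ^ (j * (q - 1)) • (fun i => C (u a 0 i)) := by
  induction j with
  | zero => simp
  | succ j ih =>
      have ha' : a + j * q ≤ T := le_trans (by nlinarith) ha
      have hbase : a + (j + 1) * q = (a + j * q) + q := by ring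
      rw [hbase, Nat.succ_mul, pow_add, ← Matrix.mulVec_mulVec,
        pow_mulVec_of_descChain A B q T hq u hB0 hB hA0 hA (a + j * q) (by rw [← hbase]; exact ha),
        Matrix.mulVec_smul, ih ha', smul_smul, ← pow_add, add_comm, add_one_mul]

/-- ★ **DESCENDING CHAINS FORCE WINDOW ORDER** (the non-vacuous instrument for (c)).  If `(K, k)` is a whole-pencil ledger of the affine pencil `N`,
`v ∈ K`, and at some point `x` the pair `(N(x), lin v)` carries a descending closed chain of width `q ≥ 2` and height `T` with bottom vector
`u 0 0 ≠ 0`, then `j·(q − 1) ≤ k` for every `j` with `j·q ≤ T` and `j·q ≤ n − 1`.  The index shadow only gives `q − 1 ≤ k`; for the repeated-block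
pencils `S_ℓ ⊗ X` (`T = ℓ − 1`, any `q ≥ 2`) this is `≈ (ℓ − 1)(q − 1)/q ≤ k` (memo). -/
theorem mul_le_of_ledger_of_descChain {n : ℕ} (N : AffMat n m) (hN : IsAffine N) {K : Submodule ℂ (Fin n × Fin n → ℂ)} {k : ℕ}
    (hK : Ledger n m N (fun _ => True) K k) {x v : Fin n × Fin n → ℂ} (hv : v ∈ K) (q T : ℕ) (hq : 2 ≤ q)
    (u : ℕ → ℕ → Fin m → ℂ) (hu0 : u 0 0 ≠ 0)
    (hB0 : ∀ a, a + 1 ≤ T → linMat N v *ᵥ u (a + 1) 0 = 0)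
    (hB : ∀ a i, a + 1 ≤ T → i + 1 < q → linMat N v *ᵥ u (a + 1) (i + 1) = u a i)
    (hA0 : ∀ a, a + 1 ≤ T → pointMat N x *ᵥ u (a + 1) 0 = u a (q - 1))
    (hA : ∀ a i, a + 1 ≤ T → 1 ≤ i → i < q → pointMat N x *ᵥ u (a + 1) i = 0)
    (j : ℕ) (hjT : j * q ≤ T) (hjn : j * q ≤ n - 1) :
    j * (q - 1) ≤ k := by
  obtain ⟨i, hi⟩ := Function.ne_iff.mp hu0
  have hturn := pow_mul_mulVec_of_descChain (pointMat N x) (linMat N v) q T hq u hB0 hB hA0 hA j 0 (by simpa using hjT)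
  rw [← map_lineSubst_eq_pointMat N hN x v] at hturn
  obtain ⟨j', hj'⟩ := exists_le_totalDegree_of_mulVec_eq _ (u (0 + j * q) 0) (u 0 0) _ hturn i hi
  exact hj'.trans (hK x v hv (j * q) hjn i j' trivial trivial)

/-! ## §3 By-name shadows, descending form -/

/-- **DESCENDING-CHAIN SHADOW OF A CERTIFICATE** (✓ `SlowCore.RelCert`): in a certificate of price `P`, a direction closed into a descending chain of
width `q` and height `T` by some value of the pencil forces `j·(q − 1) ≤ k` for all `j` with `j·q ≤ min(T, n − 1)`. -/
theorem exists_descChainShadow_of_relCert {n : ℕ} (N : AffMat n m) (hN : IsAffine N) {P : ℕ}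
    (h : SlowCore.RelCert n m N P) :
    ∃ (K : Submodule ℂ (Fin n × Fin n → ℂ)) (k : ℕ), n * k + (n * n - Module.finrank ℂ K) ≤ P ∧
      ∀ v ∈ K, ∀ (x : Fin n × Fin n → ℂ) (q T : ℕ), 2 ≤ q → ∀ u : ℕ → ℕ → Fin m → ℂ, u 0 0 ≠ 0 →
        (∀ a, a + 1 ≤ T → linMat N v *ᵥ u (a + 1) 0 = 0) →
        (∀ a i, a + 1 ≤ T → i + 1 < q → linMat N v *ᵥ u (a + 1) (i + 1) = u a i) →
        (∀ a, a + 1 ≤ T → pointMat N x *ᵥ u (a + 1) 0 = u a (q - 1)) →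
        (∀ a i, a + 1 ≤ T → 1 ≤ i → i < q → pointMat N x *ᵥ u (a + 1) i = 0) →
        ∀ j, j * q ≤ T → j * q ≤ n - 1 → j * (q - 1) ≤ k := by
  obtain ⟨K, k, hK, hprice⟩ := h
  exact ⟨K, k, hprice, fun v hv x q T hq u hu0 hB0 hB hA0 hA j hjT hjn =>
    mul_le_of_ledger_of_descChain N hN hK hv q T hq u hu0 hB0 hB hA0 hA j hjT hjn⟩

/-- **DESCENDING-CHAIN SHADOW OF THE STUB (c)** (by name, ✓ `SlowCore.LongMassSlowLawInv`).  NOT progress on (c): a necessary condition that every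
(c)-certificate must meet; a violator family is certified by exhibiting, for every cheap `(K, k)`, ONE direction `v ∈ K`, ONE point and ONE descending
chain with `j·(q − 1) > k`. -/
theorem descChainShadow_of_longMassSlowLawInv (h : SlowCore.LongMassSlowLawInv) :
    ∃ c n₀ : ℕ, ∀ n ≥ n₀, ∀ b : ℕ, ∀ B : AffMat n b, IsAffine B → B ^ b = 0 → SlowCore.IrreducibleInv B →
      ∃ (K : Submodule ℂ (Fin n × Fin n → ℂ)) (k : ℕ), n * k + (n * n - Module.finrank ℂ K) ≤ c * (Nat.sqrt n * b) ∧
        ∀ v ∈ K, ∀ (x : Fin n × Fin n → ℂ) (q T : ℕ), 2 ≤ q → ∀ u : ℕ → ℕ → Fin b → ℂ, u 0 0 ≠ 0 →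
          (∀ a, a + 1 ≤ T → linMat B v *ᵥ u (a + 1) 0 = 0) →
          (∀ a i, a + 1 ≤ T → i + 1 < q → linMat B v *ᵥ u (a + 1) (i + 1) = u a i) →
          (∀ a, a + 1 ≤ T → pointMat B x *ᵥ u (a + 1) 0 = u a (q - 1)) →
          (∀ a i, a + 1 ≤ T → 1 ≤ i → i < q → pointMat B x *ᵥ u (a + 1) i = 0) →
          ∀ j, j * q ≤ T → j * q ≤ n - 1 → j * (q - 1) ≤ k := by
  obtain ⟨c, n₀, h⟩ := h
  exact ⟨c, n₀, fun n hn b B hB hnil hirr => exists_descChainShadow_of_relCert B hB (h n hn b B hB hnil hirr)⟩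

end Summit.ValiantsHypothesis.ValiantsHypothesis.Theorems.GrenetZeon.MonomialWalk

end
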